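import Summits.Ventures.DiscreteObjects.Hadamard.Order2pNegaParity
import Summits.Ventures.DiscreteObjects.Hadamard.HadamardOrbitCounts668
import Summits.Ventures.DiscreteObjects.Hadamard.ParityPermModuleFixed

/-!
# H(668), order 22 with fixed-point-free 11th power: exactly 28 or 30 cycles of length 22 (kernel)

Framing: lottery ticket; floor = certified bounds/negative ranges.

Cell pub-namedobj (venture DiscreteObjects), target (H), hadamard gen 15.  Companion of `Order14Window668`: the mod-167 code
parity `hadamard668_aut_order22_fpf` (`44 ∣ #{j : κ² j ≠ j}`, since `167⁵ ≡ −1 (mod 44)`) combined with the order-11 orbit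
window of gen 8 (`hadamard668_signedAut_colClasses_window`: an automorphism of order `11` of an H(668) has `56`, `58` or `60`
cycles of length `11`), applied to `g²`: **`hadamard668_aut_order22_fpf_window`** — for a signed automorphism with
`π²² = κ²² = 1`, `π¹¹`, `κ¹¹` fixed-point-free and `(π², κ²) ≠ (1, 1)`, the number of columns moved by `κ²` is `616` or `660`,
i.e. `κ` has exactly `28` or `30` cycles of length `22` (and `26` or `4` two-cycles); the same on rows.  STRUCTURE, not an
exclusion.  Ours; no `sorry`.
-/

open Polynomial Finset BigOperators Matrix

namespace Summit.Ventures.DiscreteObjects.Hadamard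

open Literature.Combinatorics.Designs.GoethalsSeidel (IsHadamardMatrix)

variable {ι : Type*} [Fintype ι] [DecidableEq ι]

/-- **H(668), order 22, `g¹¹` fixed-point-free: `#{j : κ² j ≠ j} ∈ {616, 660}` and the same for `π`** — `28` or `30` cycles of
length `22` on rows and on columns. -/
theorem hadamard668_aut_order22_fpf_window {H : Matrix ι ι ℤ} (hH : IsHadamardMatrix H) (hι : Fintype.card ι = 668)
    {π κ : Equiv.Perm ι} {d e : ι → ℤ} (haut : IsSignedAut H π κ d e)
    (hπ : ∀ i, (π ^ 22) i = i) (hκ : ∀ j, (κ ^ 22) j = j) (hπf : ∀ i, (π ^ 11) i ≠ i) (hκf : ∀ j, (κ ^ 11) j ≠ j)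
    (hne : π ^ 2 ≠ 1 ∨ κ ^ 2 ≠ 1) :
    ((univ.filter (fun i => (π ^ 2) i ≠ i)).card = 616 ∨ (univ.filter (fun i => (π ^ 2) i ≠ i)).card = 660) ∧
    ((univ.filter (fun j => (κ ^ 2) j ≠ j)).card = 616 ∨ (univ.filter (fun j => (κ ^ 2) j ≠ j)).card = 660) := by
  obtain ⟨h44π, h44κ⟩ := hadamard668_aut_order22_fpf hH hι haut hπ hκ hπf hκf
  have haut2 := isSignedAut_pow_prod haut 2
  have hπ11 : (π ^ 2) ^ 11 = 1 := by
    ext i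
    rw [← pow_mul, Equiv.Perm.coe_one, id]
    exact hπ i
  have hκ11 : (κ ^ 2) ^ 11 = 1 := by
    ext j
    rw [← pow_mul, Equiv.Perm.coe_one, id]
    exact hκ j
  have h11 : (11 : ℕ) = 3 ∨ (11 : ℕ) = 5 ∨ (11 : ℕ) = 7 ∨ (11 : ℕ) = 11 := Or.inr (Or.inr (Or.inr rfl))
  obtain ⟨-, -, -, -, hwc⟩ := hadamard668_signedAut_colClasses_window hH hι h11 (π ^ 2) (κ ^ 2) _ _ haut2 hπ11 hκ11 hne
  obtain ⟨-, -, -, -, hwr⟩ := hadamard668_signedAut_rowClasses_window hH hι h11 (π ^ 2) (κ ^ 2) _ _ haut2 hπ11 hκ11 hne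
  obtain ⟨hclo, hchi⟩ := hwc rfl
  obtain ⟨hrlo, hrhi⟩ := hwr rfl
  have hcntκ : (univ.filter (fun j => (κ ^ 2) j ≠ j)).card = (blockClasses (κ ^ 2) 11).card * 11 := by
    rw [← card_moved_eq (κ ^ 2) (by norm_num : (11 : ℕ).Prime) hκ11, Fintype.card_subtype]
  have hcntπ : (univ.filter (fun i => (π ^ 2) i ≠ i)).card = (blockClasses (π ^ 2) 11).card * 11 := by
    rw [← card_moved_eq (π ^ 2) (by norm_num : (11 : ℕ).Prime) hπ11, Fintype.card_subtype]
  rw [hcntκ] at h44κ ⊢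
  rw [hcntπ] at h44π ⊢
  constructor <;> omega

end Summit.Ventures.DiscreteObjects.Hadamard
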